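import Mathlib
import HarnessLib

/-!
# Two-level central-mass law (pub-rhpf THEORY-4 §7.2; mechanism search — no RH claims)

PROVED (kernel) core of the `m = C·ε₁` law for self-dual L-functions with a central zero
(pub-rhpf STRUCTURE-D3 §D2(iii), THEORY-4 §7.2).  The model is the real symmetric `2 × 2` matrix
`M = κ·g gᵀ + λ·e eᵀ`, `g = (c, s)` with `c² + s² = 1`, `e = (0, 1)`, `0 < κ < λ`, i.e.
`M = [[κc², κcs], [κcs, κs² + λ]]`: `κ·ggᵀ` is the (effectively rank-one) restriction of the windowed
form to the near-null cluster plane and `λ·eeᵀ` the rank-one penalty of a central zero of order `r`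
(`λ = r·L·‖P_c e₀‖²`; ANALYSIS-labelled dictionary, not formalised here).  Everything is stated over
real numbers: the bottom eigenpair `(ε, (v₁, v₂))` enters through the second row of the
eigen-equation and the Vieta relations of the two eigenvalues.

* `smallerRoot_bounds` : `κλc²/(κ+λ) ≤ ε ≤ κc²` for the smaller eigenvalue;
* `ratio_div_energy_bounds` : `s/(c(λ+κ)) ≤ (−v₂/v₁)/ε ≤ s(λ+κ)/(cλ(λ−κ))`;
* `twoLevelCentralMassLaw` : the two combined — the `e`-component of the ground state is
  proportional to the ground energy, with constant `→ tan ψ/λ` as `κ → 0`;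
* `ratio_div_energy_sub_le` : the same as a linear law with relative error `2κ/(λ−κ)`.

All statements are elementary algebra ([folklore]); nothing here is a statement about ζ or any
L-function.  Decls live in the sub-namespace `…PfPersistence.TwoLevelCentralMass`.
-/

set_option linter.dupNamespace false  -- the mandated namespace repeats `RiemannHypothesis`

noncomputable section

namespace Summit.RiemannHypothesis.RiemannHypothesis.Theorems.PfPersistence.TwoLevelCentralMass

/-- PROVED: the characteristic polynomial of `[[κc², κcs],[κcs, κs²+λ]]` is `x² − (κ+λ)x + κλc²`
when `c² + s² = 1`. [folklore] -/
theorem charpoly_eq {κ lam c s : ℝ} (hcs : c ^ 2 + s ^ 2 = 1) (x : ℝ) :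
    (κ * c ^ 2 - x) * (κ * s ^ 2 + lam - x) - (κ * c * s) * (κ * c * s)
      = x ^ 2 - (κ + lam) * x + κ * lam * c ^ 2 := by
  linear_combination (-(κ * x)) * hcs

/-- PROVED: if `ε ≤ ε'` satisfy the Vieta relations of that characteristic polynomial
(`ε + ε' = κ + λ`, `ε·ε' = κλc²`) with `κ, λ > 0`, `c > 0`, `c² + s² = 1`, then
`κλc²/(κ+λ) ≤ ε ≤ κc²` (the smaller eigenvalue lies between `det/tr` and `M₁₁`). [folklore] -/
theorem smallerRoot_bounds {κ lam c s ε ε' : ℝ} (hκ : 0 < κ) (hlam : 0 < lam) (hc : 0 < c)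
    (hcs : c ^ 2 + s ^ 2 = 1) (hsum : ε + ε' = κ + lam) (hprod : ε * ε' = κ * lam * c ^ 2)
    (hle : ε ≤ ε') :
    κ * lam * c ^ 2 / (κ + lam) ≤ ε ∧ ε ≤ κ * c ^ 2 := by
  have hD : 0 < κ * lam * c ^ 2 := by positivity
  have hT : 0 < κ + lam := by linarith
  -- the smaller root is positive
  have hε : 0 < ε := by
    by_contra h
    push Not at h
    have hε' : κ + lam ≤ ε' := by linarith
    nlinarith [mul_nonneg (neg_nonneg.mpr h) (le_trans hT.le hε')]
  constructor
  · -- `det/tr ≤ ε`  ⟸  `ε·(κ+λ) = ε² + det`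
    have h6 : ε * (κ + lam) = ε ^ 2 + κ * lam * c ^ 2 := by rw [← hsum, ← hprod]; ring
    rw [div_le_iff₀ hT]
    nlinarith [h6, sq_nonneg ε]
  · -- `ε ≤ M₁₁ = κc²`  ⟸  `q(κc²) = −κ²c²s² ≤ 0`
    by_contra h
    push Not at h
    have h2 : κ * c ^ 2 < ε' := lt_of_lt_of_le h hle
    have hpos : 0 < (ε - κ * c ^ 2) * (ε' - κ * c ^ 2) := mul_pos (sub_pos.mpr h) (sub_pos.mpr h2)
    have h3 : κ * c ^ 2 * ε + κ * c ^ 2 * ε' = κ * c ^ 2 * (κ + lam) := by rw [← hsum]; ring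
    have h4 : κ ^ 2 * c ^ 2 * c ^ 2 + κ ^ 2 * c ^ 2 * s ^ 2 = κ ^ 2 * c ^ 2 := by
      rw [show κ ^ 2 * c ^ 2 * c ^ 2 + κ ^ 2 * c ^ 2 * s ^ 2 = κ ^ 2 * c ^ 2 * (c ^ 2 + s ^ 2) by ring,
        hcs, mul_one]
    have h5 : 0 ≤ κ ^ 2 * c ^ 2 * s ^ 2 := by positivity
    nlinarith [hpos, hprod, h3, h4, h5]

/-- PROVED: from the second row of the eigen-equation, `κcs·v₁ + (κs² + λ − ε)·v₂ = 0`, the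
component ratio is `−v₂/v₁ = κcs/(κs² + λ − ε)`. [folklore] -/
theorem ratio_eq {κ lam c s ε v₁ v₂ : ℝ} (hv₁ : v₁ ≠ 0)
    (hrow : κ * c * s * v₁ + (κ * s ^ 2 + lam - ε) * v₂ = 0)
    (hD : κ * s ^ 2 + lam - ε ≠ 0) :
    -v₂ / v₁ = κ * c * s / (κ * s ^ 2 + lam - ε) := by
  rw [div_eq_div_iff hv₁ hD]
  linear_combination (-1 : ℝ) * hrow

/-- PROVED (the sandwich): with `0 < κ < λ`, `c, s > 0`, `c² + s² = 1`, `v₁ > 0`, the second-row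
eigen-equation and `κλc²/(κ+λ) ≤ ε ≤ κc²`,
`s/(c(λ+κ)) ≤ (−v₂/v₁)/ε ≤ s(λ+κ)/(cλ(λ−κ))`. [folklore] -/
theorem ratio_div_energy_bounds {κ lam c s ε v₁ v₂ : ℝ} (hκ : 0 < κ) (hκl : κ < lam)
    (hc : 0 < c) (hs : 0 < s) (hcs : c ^ 2 + s ^ 2 = 1) (hv₁ : 0 < v₁)
    (hrow : κ * c * s * v₁ + (κ * s ^ 2 + lam - ε) * v₂ = 0)
    (hεlo : κ * lam * c ^ 2 / (κ + lam) ≤ ε) (hεhi : ε ≤ κ * c ^ 2) :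
    s / (c * (lam + κ)) ≤ (-v₂ / v₁) / ε ∧
      (-v₂ / v₁) / ε ≤ s * (lam + κ) / (c * lam * (lam - κ)) := by
  have hlam : 0 < lam := lt_trans hκ hκl
  have hT : 0 < κ + lam := by linarith
  have hεpos : 0 < ε := lt_of_lt_of_le (by positivity) hεlo
  have hκcs : κ * c ^ 2 + κ * s ^ 2 = κ := by rw [← mul_add, hcs, mul_one]
  have hκs2 : 0 ≤ κ * s ^ 2 := by positivity
  have hκc2 : 0 ≤ κ * c ^ 2 := by positivity
  -- the denominator `D = κs² + λ − ε` is trapped in `[λ − κ, λ + κ]`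
  have hDlo : lam - κ ≤ κ * s ^ 2 + lam - ε := by linarith
  have hDhi : κ * s ^ 2 + lam - ε ≤ lam + κ := by linarith
  have hDpos : 0 < κ * s ^ 2 + lam - ε := by linarith
  rw [ratio_eq hv₁.ne' hrow hDpos.ne', div_div]
  constructor
  · rw [div_le_div_iff₀ (by positivity) (mul_pos hDpos hεpos)]
    have hmul : (κ * s ^ 2 + lam - ε) * ε ≤ (lam + κ) * (κ * c ^ 2) :=
      mul_le_mul hDhi hεhi hεpos.le (by positivity)
    calc s * ((κ * s ^ 2 + lam - ε) * ε) ≤ s * ((lam + κ) * (κ * c ^ 2)) :=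
          mul_le_mul_of_nonneg_left hmul hs.le
      _ = κ * c * s * (c * (lam + κ)) := by ring
  · rw [div_le_div_iff₀ (mul_pos hDpos hεpos) (by nlinarith [mul_pos hc hlam, sub_pos.mpr hκl])]
    have h1 : κ * lam * c ^ 2 ≤ (κ + lam) * ε := by
      have := hεlo; rw [div_le_iff₀ hT] at this; linarith
    have hmul : (lam - κ) * (κ * lam * c ^ 2) ≤ (κ * s ^ 2 + lam - ε) * ((κ + lam) * ε) :=
      mul_le_mul hDlo h1 (by positivity) hDpos.le
    calc κ * c * s * (c * lam * (lam - κ)) = s * ((lam - κ) * (κ * lam * c ^ 2)) := by ring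
      _ ≤ s * ((κ * s ^ 2 + lam - ε) * ((κ + lam) * ε)) := mul_le_mul_of_nonneg_left hmul hs.le
      _ = s * (lam + κ) * ((κ * s ^ 2 + lam - ε) * ε) := by ring

/-- **Two-level central-mass law** (PROVED; THEORY-4 §7.2).  For `M = κ·ggᵀ + λ·eeᵀ` with
`0 < κ < λ`, `g = (c, s)`, `c, s > 0`, `c² + s² = 1`: if `ε ≤ ε'` are its eigenvalues (Vieta
relations) and `(v₁, v₂)`, `v₁ > 0`, solves the second row of `(M − ε)v = 0`, then
`s/(c(λ+κ)) ≤ (−v₂/v₁)/ε ≤ s(λ+κ)/(cλ(λ−κ))`; both bounds tend to `tan ψ/λ` (`c = cos ψ`,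
`s = sin ψ`) as `κ → 0⁺`: the `e`-component of the ground state is proportional to the ground
energy across as many orders of magnitude as `κ` ranges over. [folklore] -/
theorem twoLevelCentralMassLaw {κ lam c s ε ε' v₁ v₂ : ℝ} (hκ : 0 < κ) (hκl : κ < lam)
    (hc : 0 < c) (hs : 0 < s) (hcs : c ^ 2 + s ^ 2 = 1)
    (hsum : ε + ε' = κ + lam) (hprod : ε * ε' = κ * lam * c ^ 2) (hle : ε ≤ ε')
    (hv₁ : 0 < v₁) (hrow : κ * c * s * v₁ + (κ * s ^ 2 + lam - ε) * v₂ = 0) :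
    s / (c * (lam + κ)) ≤ (-v₂ / v₁) / ε ∧
      (-v₂ / v₁) / ε ≤ s * (lam + κ) / (c * lam * (lam - κ)) :=
  have hb := smallerRoot_bounds hκ (lt_trans hκ hκl) hc hcs hsum hprod hle
  ratio_div_energy_bounds hκ hκl hc hs hcs hv₁ hrow hb.1 hb.2

/-- PROVED: the law as a linear relation with explicit relative error:
`|(−v₂/v₁)/ε − s/(cλ)| ≤ (s/(cλ))·(2κ/(λ−κ))`. [folklore] -/
theorem ratio_div_energy_sub_le {κ lam c s ε ε' v₁ v₂ : ℝ} (hκ : 0 < κ) (hκl : κ < lam)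
    (hc : 0 < c) (hs : 0 < s) (hcs : c ^ 2 + s ^ 2 = 1)
    (hsum : ε + ε' = κ + lam) (hprod : ε * ε' = κ * lam * c ^ 2) (hle : ε ≤ ε')
    (hv₁ : 0 < v₁) (hrow : κ * c * s * v₁ + (κ * s ^ 2 + lam - ε) * v₂ = 0) :
    |(-v₂ / v₁) / ε - s / (c * lam)| ≤ s / (c * lam) * (2 * κ / (lam - κ)) := by
  obtain ⟨hlo, hhi⟩ := twoLevelCentralMassLaw hκ hκl hc hs hcs hsum hprod hle hv₁ hrow
  have hlam : 0 < lam := lt_trans hκ hκl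
  have hgap : 0 < lam - κ := sub_pos.mpr hκl
  have hbase : 0 ≤ s / (c * lam) := by positivity
  rw [abs_le]
  constructor
  · have key : s / (c * (lam + κ)) = s / (c * lam) - s / (c * lam) * (κ / (lam + κ)) := by
      field_simp
      ring
    have hfrac : κ / (lam + κ) ≤ 2 * κ / (lam - κ) := by
      rw [div_le_div_iff₀ (by linarith) hgap]
      nlinarith
    have := mul_le_mul_of_nonneg_left hfrac hbase
    linarith
  · have key : s * (lam + κ) / (c * lam * (lam - κ))
        = s / (c * lam) + s / (c * lam) * (2 * κ / (lam - κ)) := by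
      field_simp
      ring
    linarith

end Summit.RiemannHypothesis.RiemannHypothesis.Theorems.PfPersistence.TwoLevelCentralMass

end
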